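import Summits.KontsevichZagierPeriods.KontsevichZagierPeriods.Theorems.KzOnePeriodsG0DerivLoops
import Summits.KontsevichZagierPeriods.KontsevichZagierPeriods.Theorems.KzOnePeriodsG0DerivLogarithms

/-!
# KontsevichZagierPeriods — kz1p (R1)–(R5) derivations, part 5: assembly and the case-file interface

Cell pub-kz1p, seat b2b-kz1p-2, gen 12 (kz1p v1.3; PROCEDURE.md §4d; LEAN-IN-TREE rule).  Pure mathematics over the
tree's formal period space `Literature.NumberTheory.Transcendental.CurvePeriods` (period symbols `(Z, ω, γ)`, the
elementary relations `IsElementaryRelation` = the moves (R1) additivity, (R2) vanishing forms, (R3) exact forms /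
Stokes, (R4) functoriality, (R5) subdivision of [cite: HuberWustholz2022, §13.1 (p. 120)], and the evaluation
`evalCombination` = `Σ cᵢ ∫_{γᵢ} ωᵢ`, sound by [cite: HuberWustholz2022, Thm. 13.3 (2)] =
`evalCombination_eq_zero_of_isElementaryRelation`).  No named facts are used, no `sorry`.

Parts 1–5 (`KzOnePeriodsG0Deriv{LogSegment,Segments,Loops,Logarithms}.lean` and this file) are the GENERIC part of kz1p's relation certificates for the class G0 (differentials
`ω = Σᵢ rcᵢ dx/(x − aᵢ) + dP` on `Z_a = 𝔸¹ ∖ {a₁,…,a_r}`, realised as the smooth affine curve `y ∏ (x − aᵢ) = 1`,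
integrated along segments `[z₀, z₁]` missing the `aᵢ` and along small positive loops around one `a_c`):
every step of the decision procedure's reduction (PROCEDURE.md §1) is a theorem producing an element of the
`ℚ̄`-span of elementary relations ("`InSpanRel`"):

* `span_segmentSymbol` / `red_segment` — (R1)+(R3)+(R4)+A-hom: `[Z_a, ω, segment] − Σᵢ rcᵢ [𝔾ₘ, dy/y… ℓ(Log wᵢ)] − (P(z₁) − P(z₀))·[unit]`
  is a `ℚ̄`-combination of elementary relations, where `wᵢ = (z₁ − aᵢ)/(z₀ − aᵢ)` and `ℓ(M)` is the standard path
  `t ↦ exp (t M)` on `𝔾ₘ` (principal logarithm along a segment: `exists_log_segment`);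
* `span_loopSymbol` / `red_loop` — the same for a loop of radius `ρ` around `a_c` (radius below the distance to the
  other poles): `[Z_a, ω, loop] − rc_c [𝔾ₘ, y dx, ℓ(2πi)]`;
* `span_latticeRelation_int` / `_real` — (R4) along `z ↦ z^k`, multiplicativity and (R5): an integer relation
  `Σ k_j M_j = 0` among logarithms `M_j` (`exp M_j ∈ ℚ̄`) gives `Σ k_j [ℓ(M_j)] ∼ 0`; the real version takes a
  multiplicative identity `∏ x_j^{kp_j} = ∏ x_j^{kn_j}` of positive reals; the complex case files reach `Σ k_j M_j = 0`
  through the principal-value product rule `log (x y) = log x + log y + c·2πi`, `c ∈ {−1, 0, 1}` decided by signs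
  (`log_mul_of_*`), and the logarithms of the roots of unity of `ℚ(i)`, `ℚ(√−3)` (`log_lit_*`);
* `span_assembly` — the final exact linear algebra: given the symbol reductions, the lattice relations and a
  certificate `(λ_t)` with `Σᵢ αᵢ βᵢ = Σ_t λ_t K_t` and `Σᵢ αᵢ R1ᵢ = 0`, the INPUT combination `Σ αᵢ [Sᵢ]` is in the span;
* `evalCombination_eq_zero_of_span` — soundness: anything in the span evaluates to `0`;
* `exists_segPath`, `exists_loopPath`, `exists_genPaths`, `segment_misses` — the hypothesised `C¹` paths exist.

The per-case files `numerics/kz1p/out/lean/Deriv_G0_<id>.lean` (generated by `kz1p/lean_deriv.py` from the corpus case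
and kz1p's JSON certificate) import this module and prove `derivation : InSpanRel (Σ αᵢ • [Sᵢ])` for the literal input
data, `relation : Σ αᵢ ∫ Sᵢ = 0`, and `paths_exist`; they close only sign conditions and identities in `K` by
`norm_num` / `linarith`.  Scope: `K ∈ {ℚ, ℚ(i), ℚ(√d)}`, simple poles plus polynomial part.
-/

noncomputable section

open scoped BigOperators Real
open MvPolynomial Set Complex
open Literature.NumberTheory.Transcendental
open Literature.NumberTheory.Transcendental.CurvePeriods

noncomputable section

open scoped BigOperators Real
open MvPolynomial Set Complex
open Literature.NumberTheory.Transcendental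
open Literature.NumberTheory.Transcendental.CurvePeriods

namespace Summit.KontsevichZagierPeriods.KzOnePeriods.G0Derivation

local notation3 "InSpanRel " c:arg => ∃ (k : ℕ) (ρ : Fin k → (PeriodSymbol →₀ ℂ))
  (a : Fin k → ℂ), (∀ l, IsElementaryRelation (ρ l)) ∧ (∀ l, IsAlgebraic ℚ (a l)) ∧
    c = ∑ l, a l • ρ l

local notation3 (prettyPrint := false) "𝔾m" => (⟨2, 1, ![X 0 * X 1 - 1]⟩ : CurveData)

local notation3 "logSym " E:arg => (⟨⟨2, 1, ![X 0 * X 1 - 1]⟩, isSmoothAffineCurve_mulGroup,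
  ![X 1, 0], hasAlgCoeffs_ydx, E⟩ : PeriodSymbol)

/-! ### Assembly: from symbol reductions and lattice relations to the input relation -/

/-- Re-indexing a double sum of scalar multiples along `idx`. [folklore] -/
theorem sum_smul_reindex {n r m : ℕ} (ℓ : Fin m → (PeriodSymbol →₀ ℂ))
    (idx : Fin n → Fin r → Fin m) (β : Fin n → Fin r → ℂ) :
    ∑ i, ∑ q, β i q • ℓ (idx i q) =
      ∑ j, (∑ i, ∑ q, if idx i q = j then β i q else 0) • ℓ j := by
  calc ∑ i, ∑ q, β i q • ℓ (idx i q)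
      = ∑ i, ∑ q, ∑ j, (if idx i q = j then β i q • ℓ j else 0) := by
          refine Finset.sum_congr rfl fun i _ => Finset.sum_congr rfl fun q _ => ?_
          rw [Finset.sum_ite_eq, if_pos (Finset.mem_univ _)]
    _ = ∑ i, ∑ j, ∑ q, (if idx i q = j then β i q • ℓ j else 0) :=
          Finset.sum_congr rfl fun i _ => Finset.sum_comm
    _ = ∑ j, ∑ i, ∑ q, (if idx i q = j then β i q • ℓ j else 0) := Finset.sum_comm
    _ = ∑ j, (∑ i, ∑ q, if idx i q = j then β i q else 0) • ℓ j := by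
          refine Finset.sum_congr rfl fun j _ => ?_
          rw [Finset.sum_smul]
          refine Finset.sum_congr rfl fun i _ => ?_
          rw [Finset.sum_smul]
          refine Finset.sum_congr rfl fun q _ => ?_
          split_ifs <;> simp

/-- **kz1p assembly.** Symbols `Sᵢ` with reductions `Sᵢ ∼ Σ_q βᵢq ℓ(M_{idx i q}) + R¹ᵢ · 𝟙`,
lattice relations `Σⱼ K_tj ℓ(Mⱼ) ∼ 0`, and the exact linear algebra
`Σᵢ αᵢ βᵢ• = Σ_t λ_t K_t•`, `Σᵢ αᵢ R¹ᵢ = 0` (`αᵢ, λ_t ∈ ℚ̄`) give `Σᵢ αᵢ Sᵢ ∼ 0`.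
[cite: HuberWustholz2022, §13.1 (p. 120)] -/
theorem span_assembly {n r m T : ℕ} (S : Fin n → (PeriodSymbol →₀ ℂ)) (α : Fin n → ℂ)
    (hα : ∀ i, IsAlgebraic ℚ (α i)) (ℓ : Fin m → (PeriodSymbol →₀ ℂ)) (u : PeriodSymbol →₀ ℂ)
    (idx : Fin n → Fin r → Fin m) (β : Fin n → Fin r → ℂ) (R1 : Fin n → ℂ)
    (hred : ∀ i, InSpanRel (S i - ∑ q, β i q • ℓ (idx i q) - R1 i • u))
    (K : Fin T → Fin m → ℂ) (hrel : ∀ t, InSpanRel (∑ j, K t j • ℓ j))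
    (lam : Fin T → ℂ) (hlam : ∀ t, IsAlgebraic ℚ (lam t))
    (hcoef : ∀ j, (∑ i, ∑ q, if idx i q = j then α i * β i q else 0) = ∑ t, lam t * K t j)
    (hone : ∑ i, α i * R1 i = 0) :
    InSpanRel (∑ i, α i • S i) := by
  have h₁ : InSpanRel (∑ i, α i • (S i - ∑ q, β i q • ℓ (idx i q) - R1 i • u)) :=
    span_finsetSum _ _ fun i _ => span_smul (hα i) (hred i)
  have h₂ : InSpanRel (∑ t, lam t • ∑ j, K t j • ℓ j) :=
    span_finsetSum _ _ fun t _ => span_smul (hlam t) (hrel t)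
  have e₁ : ∑ i, α i • ∑ q, β i q • ℓ (idx i q) = ∑ j, (∑ t, lam t * K t j) • ℓ j := by
    simp_rw [Finset.smul_sum, smul_smul]
    rw [sum_smul_reindex ℓ idx (fun i q => α i * β i q)]
    exact Finset.sum_congr rfl fun j _ => by rw [hcoef j]
  have e₂ : ∑ t, lam t • ∑ j, K t j • ℓ j = ∑ j, (∑ t, lam t * K t j) • ℓ j := by
    simp_rw [Finset.smul_sum, smul_smul, Finset.sum_smul]
    rw [Finset.sum_comm]
  have e₃ : ∑ i, α i • (R1 i • u) = 0 := by
    simp_rw [smul_smul, ← Finset.sum_smul, hone, zero_smul]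
  have key : ∑ i, α i • S i =
      ∑ i, α i • (S i - ∑ q, β i q • ℓ (idx i q) - R1 i • u) + ∑ t, lam t • ∑ j, K t j • ℓ j := by
    simp only [smul_sub, Finset.sum_sub_distrib, e₁, e₂, e₃]
    abel
  rw [key]
  exact span_add h₁ h₂

/-- **Soundness**: a combination in the span of the elementary relations evaluates to `0`
(`Σ c_s ∫_{γ_s} ω_s = 0`). [cite: HuberWustholz2022, Thm. 13.3 (2) (p. 121)] -/
theorem evalCombination_eq_zero_of_span {c : PeriodSymbol →₀ ℂ} (h : InSpanRel c) :
    evalCombination c = 0 := by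
  obtain ⟨k, ρ, a, hρ, _, rfl⟩ := h
  exact evalCombination_eq_zero_of_isElementaryRelation ρ a hρ

/-- Evaluation of `Σ αᵢ · [Sᵢ]` is `Σ αᵢ ∫ Sᵢ`. [folklore] -/
theorem evalCombination_sum_smul_single {n : ℕ} (S : Fin n → PeriodSymbol) (α : Fin n → ℂ) :
    evalCombination (∑ i, α i • Finsupp.single (S i) (1 : ℂ)) = ∑ i, α i * (S i).period := by
  rw [evalCombination_finsetSum]
  exact Finset.sum_congr rfl fun i _ => by
    rw [evalCombination_smul, evalCombination_single, one_mul]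

/-! ### Principal logarithms of the roots of unity of `ℚ(i)` and `ℚ(√-3)` (literal form used by the case files) -/
section LogLits

/-- `Log (exp (iθ)) = iθ` for `θ ∈ (−π, π]`. [folklore] -/
private theorem log_exp_angle (θ : ℝ) (h₁ : -π < θ) (h₂ : θ ≤ π) :
    log (exp ((θ : ℂ) * I)) = (θ : ℂ) * I := by
  apply Complex.log_exp <;> simp <;> linarith

/-- `⟨cos θ, sin θ⟩ = exp (iθ)`. [folklore] -/
private theorem mk_eq_exp_angle (θ : ℝ) (x y : ℝ) (hx : Real.cos θ = x) (hy : Real.sin θ = y) :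
    (⟨x, y⟩ : ℂ) = exp ((θ : ℂ) * I) := by
  rw [Complex.exp_mul_I, ← Complex.ofReal_cos, ← Complex.ofReal_sin, hx, hy]
  apply Complex.ext <;> simp

/-- `Log 1 = 0 · 2πi` (literal form). [folklore] -/
theorem log_lit_one : log (⟨1, 0⟩ : ℂ) = (0 : ℂ) * (2 * π * I) := by
  have : (⟨1, 0⟩ : ℂ) = 1 := by apply Complex.ext <;> simp
  rw [this, Complex.log_one]; ring

/-- `Log (−1) = ½ · 2πi` (literal form). [folklore] -/
theorem log_lit_neg_one : log (⟨(-1), 0⟩ : ℂ) = ((1/2) : ℂ) * (2 * π * I) := by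
  have : (⟨(-1), 0⟩ : ℂ) = -1 := by apply Complex.ext <;> simp
  rw [this, Complex.log_neg_one]; ring

/-- `Log i = ¼ · 2πi` (literal form). [folklore] -/
theorem log_lit_I : log (⟨0, 1⟩ : ℂ) = ((1/4) : ℂ) * (2 * π * I) := by
  have : (⟨0, 1⟩ : ℂ) = I := by apply Complex.ext <;> simp
  rw [this, Complex.log_I]; ring

/-- `Log (−i) = −¼ · 2πi` (literal form). [folklore] -/
theorem log_lit_neg_I : log (⟨0, (-1)⟩ : ℂ) = ((-1/4) : ℂ) * (2 * π * I) := by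
  have : (⟨0, (-1)⟩ : ℂ) = -I := by apply Complex.ext <;> simp
  rw [this, Complex.log_neg_I]; ring

/-- `Log ζ₆ = ⅙ · 2πi`, `ζ₆ = ½ + ½√−3` (literal form). [folklore] -/
theorem log_lit_zeta6 :
    log (⟨(1/2), ((1/2) * Real.sqrt 3)⟩ : ℂ) = ((1/6) : ℂ) * (2 * π * I) := by
  have e := mk_eq_exp_angle (π / 3) (1/2) ((1/2) * Real.sqrt 3)
    (by rw [Real.cos_pi_div_three]) (by rw [Real.sin_pi_div_three]; ring)
  rw [e, log_exp_angle _ (by linarith [Real.pi_pos]) (by linarith [Real.pi_pos])]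
  push_cast; ring

/-- `Log ζ₆⁻¹ = −⅙ · 2πi` (literal form). [folklore] -/
theorem log_lit_zeta6_inv :
    log (⟨(1/2), ((-1/2) * Real.sqrt 3)⟩ : ℂ) = ((-1/6) : ℂ) * (2 * π * I) := by
  have e := mk_eq_exp_angle (-(π / 3)) (1/2) ((-1/2) * Real.sqrt 3)
    (by rw [Real.cos_neg, Real.cos_pi_div_three]) (by rw [Real.sin_neg, Real.sin_pi_div_three]; ring)
  rw [e, log_exp_angle _ (by linarith [Real.pi_pos]) (by linarith [Real.pi_pos])]
  push_cast; ring

/-- `Log ζ₃ = ⅓ · 2πi`, `ζ₃ = −½ + ½√−3` (literal form). [folklore] -/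
theorem log_lit_zeta3 :
    log (⟨(-1/2), ((1/2) * Real.sqrt 3)⟩ : ℂ) = ((1/3) : ℂ) * (2 * π * I) := by
  have e := mk_eq_exp_angle (π - π / 3) (-1/2) ((1/2) * Real.sqrt 3)
    (by rw [Real.cos_pi_sub, Real.cos_pi_div_three]; ring) (by rw [Real.sin_pi_sub, Real.sin_pi_div_three]; ring)
  rw [e, log_exp_angle _ (by linarith [Real.pi_pos]) (by linarith [Real.pi_pos])]
  push_cast; ring

/-- `Log ζ₃⁻¹ = −⅓ · 2πi` (literal form). [folklore] -/
theorem log_lit_zeta3_inv :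
    log (⟨(-1/2), ((-1/2) * Real.sqrt 3)⟩ : ℂ) = ((-1/3) : ℂ) * (2 * π * I) := by
  have e := mk_eq_exp_angle (-(π - π / 3)) (-1/2) ((-1/2) * Real.sqrt 3)
    (by rw [Real.cos_neg, Real.cos_pi_sub, Real.cos_pi_div_three]; ring)
    (by rw [Real.sin_neg, Real.sin_pi_sub, Real.sin_pi_div_three]; ring)
  rw [e, log_exp_angle _ (by linarith [Real.pi_pos]) (by linarith [Real.pi_pos])]
  push_cast; ring

/-- `0 < a + b·√d` when `b > 0` dominates a possibly negative `a`. -/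
theorem add_mul_sqrt_pos' {a b d : ℝ} (hd : 0 ≤ d) (hb : 0 < b) (h : a ^ 2 < b ^ 2 * d) :
    0 < a + b * Real.sqrt d := by
  have hs : Real.sqrt d ^ 2 = d := Real.sq_sqrt hd
  have hsn : 0 ≤ Real.sqrt d := Real.sqrt_nonneg d
  by_cases ha : 0 ≤ a
  · have : 0 < b * Real.sqrt d := by
      apply mul_pos hb
      rcases lt_or_eq_of_le hsn with h' | h'
      · exact h'
      · exfalso; rw [← h'] at hs; simp at hs; rw [← hs] at h; nlinarith [sq_nonneg a]
    linarith
  · push Not at ha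
    by_contra hcon
    push Not at hcon
    have h1 : 0 ≤ -a - b * Real.sqrt d := by linarith
    have h2 : 0 ≤ -a + b * Real.sqrt d := by nlinarith [mul_nonneg hb.le hsn]
    have h3 := mul_nonneg h1 h2
    have hs2 : (b * Real.sqrt d) ^ 2 = b ^ 2 * d := by rw [mul_pow, hs]
    nlinarith [h3, hs2]

/-- `⟨0, 0⟩ = 0`. [folklore] -/
theorem mk_zero_zero : (⟨0, 0⟩ : ℂ) = 0 := by apply Complex.ext <;> simp

/-- `⟨1, 0⟩ = 1`. [folklore] -/
theorem mk_one_zero : (⟨1, 0⟩ : ℂ) = 1 := by apply Complex.ext <;> simp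

end LogLits

/-! ### Interface for the generated per-case derivations

The generated files (`numerics/kz1p/out/lean/Deriv_G0_*.lean`) only instantiate the following
wrappers with literal data from the number field `K` and discharge sign / identity side
conditions by `norm_num` (over `ℚ`, `ℚ(i)`) or `√d`-arithmetic (quadratic `K`). -/

section Interface

variable {r : ℕ}

local notation3 (prettyPrint := false) "ZP " a:arg =>
  (⟨2, 1, ![X 1 * ∏ i, (X 0 - C (a i)) - 1]⟩ : CurveData)

/-- `i` is algebraic. [folklore] -/
theorem isAlgebraic_I : IsAlgebraic ℚ I :=
  ⟨Polynomial.X ^ 2 + Polynomial.C 1, Polynomial.X_pow_add_C_ne_zero two_pos 1, by simp⟩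

/-- `√d` is algebraic. [folklore] -/
theorem isAlgebraic_sqrt (d : ℕ) : IsAlgebraic ℚ ((Real.sqrt d : ℝ) : ℂ) := by
  refine ⟨Polynomial.X ^ 2 - Polynomial.C (d : ℚ), Polynomial.X_pow_sub_C_ne_zero two_pos _, ?_⟩
  have h : ((Real.sqrt d : ℝ) : ℂ) ^ 2 = (d : ℂ) := by
    rw [← ofReal_pow, Real.sq_sqrt (Nat.cast_nonneg d)]; push_cast; rfl
  simp [h]

/-- Elements of `ℚ(i)` written in coordinates are algebraic. [folklore] -/
theorem isAlgebraic_of_eq_rat {z : ℂ} (a b : ℚ) (h : z = a + b * I) : IsAlgebraic ℚ z := by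
  rw [h]; exact (isAlgebraic_algebraMap a).add ((isAlgebraic_algebraMap b).mul isAlgebraic_I)

/-- Elements of `ℚ(√d, i)` written in coordinates are algebraic. [folklore] -/
theorem isAlgebraic_of_eq_sqrt {z : ℂ} (d : ℕ) (a b c e : ℚ)
    (h : z = a + b * ((Real.sqrt d : ℝ) : ℂ) + (c + e * ((Real.sqrt d : ℝ) : ℂ)) * I) :
    IsAlgebraic ℚ z := by
  rw [h]
  exact ((isAlgebraic_algebraMap a).add ((isAlgebraic_algebraMap b).mul (isAlgebraic_sqrt d))).add
    (((isAlgebraic_algebraMap c).add ((isAlgebraic_algebraMap e).mul (isAlgebraic_sqrt d))).mul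
      isAlgebraic_I)

/-- Membership in the slit plane from the coordinates. [folklore] -/
theorem mem_slitPlane_of_re_im {w : ℂ} (h : 0 < w.re ∨ w.im ≠ 0) : w ∈ slitPlane := h

/-- **The family of logarithm-symbol paths `E_j = E_{0, M_j}` exists** for generators `M_j` with
`e^{M_j} ∈ ℚ̄`. [folklore] -/
theorem exists_genPaths {m : ℕ} (M : Fin m → ℂ) (hM : ∀ j, IsAlgebraic ℚ (exp (M j))) :
    ∃ E : Fin m → CurvePath 𝔾m, ∀ j t, (E j).toFun t =
      ![exp ((1 - t) * 0 + t * M j), exp (-((1 - t) * 0 + t * M j))] :=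
  ⟨fun j => Classical.choose (exists_expPath (L₀ := 0) (L₁ := M j) isAlgebraic_exp_zero (hM j)),
    fun j => Classical.choose_spec (exists_expPath (L₀ := 0) (L₁ := M j) isAlgebraic_exp_zero (hM j))⟩

/-- **Segment reduction, generator-indexed** (the form used by the generated derivations):
`(Z_a, ω, [z₀,z₁]) ∼ Σ_j (Σ_{q : idx q = j} r_q) ℓ(M_j) + (P(z₁) − P(z₀)) 𝟙` where
`M_{idx q} = Log w_q`, `w_q (z₀ − a_q) = z₁ − a_q`.
[cite: HuberWustholz2022, §13.1 (A)–(B) (p. 120), §3.3.1 (pp. 42–43)] -/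
theorem red_segment {a : Fin r → ℂ} (ha : ∀ i, IsAlgebraic ℚ (a i)) {rc : Fin r → ℂ}
    (hrc : ∀ i, IsAlgebraic ℚ (rc i)) {d : ℕ} {pc : Fin d → ℂ} (hpc : ∀ k, IsAlgebraic ℚ (pc k))
    {z₀ z₁ : ℂ} (hz₀ : IsAlgebraic ℚ z₀) (γ : CurvePath (ZP a))
    (hγ : ∀ t ∈ Icc (0 : ℝ) 1, γ.toFun t = ![z₀ + t * (z₁ - z₀), (∏ i, (z₀ + t * (z₁ - z₀) - a i))⁻¹])
    {m : ℕ} (M : Fin m → ℂ) (E : Fin m → CurvePath 𝔾m)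
    (hE : ∀ j t, (E j).toFun t = ![exp ((1 - t) * 0 + t * M j), exp (-((1 - t) * 0 + t * M j))])
    (w : Fin r → ℂ) (idx : Fin r → Fin m) (hidx : ∀ q, M (idx q) = log (w q))
    (hw : ∀ i, w i * (z₀ - a i) = z₁ - a i) (hslit : ∀ i, 0 < (w i).re ∨ (w i).im ≠ 0) :
    InSpanRel (Finsupp.single (⟨ZP a, isSmoothAffineCurve_puncturedLine ha, inputForm a rc pc,
        hasAlgCoeffs_inputForm ha hrc hpc, γ⟩ : PeriodSymbol) (1 : ℂ) -
      ∑ j, (∑ q, if idx q = j then rc q else 0) • Finsupp.single (logSym (E j)) (1 : ℂ) -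
      (polyPrimVal pc z₁ - polyPrimVal pc z₀) • Finsupp.single PeriodSymbol.unit (1 : ℂ)) := by
  have h := span_segmentSymbol ha hrc hpc hz₀ γ hγ w hw (fun i => mem_slitPlane_of_re_im (hslit i))
    (fun q => E (idx q)) (fun q t => by rw [hE, hidx])
  have e : ∑ q, rc q • Finsupp.single (logSym (E (idx q))) (1 : ℂ) =
      ∑ j, (∑ q, if idx q = j then rc q else 0) • Finsupp.single (logSym (E j)) (1 : ℂ) := by
    have h1 := sum_smul_reindex (n := 1) (fun j => Finsupp.single (logSym (E j)) (1 : ℂ))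
      (fun _ q => idx q) (fun _ q => rc q)
    simpa using h1
  rwa [e] at h

/-- **Loop reduction, generator-indexed**: `(Z_a, ω, circle around a_c) ∼ r_c ℓ(2πi) + 0 · 𝟙` with
`M_{j₀} = 2πi`. [cite: HuberWustholz2022, §13.1 (A)–(B) (p. 120), §10.1 (p. 96)] -/
theorem red_loop {a : Fin r → ℂ} (ha : ∀ i, IsAlgebraic ℚ (a i)) {rc : Fin r → ℂ}
    (hrc : ∀ i, IsAlgebraic ℚ (rc i)) {d : ℕ} {pc : Fin d → ℂ} (hpc : ∀ k, IsAlgebraic ℚ (pc k))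
    (c : Fin r) {ρ : ℝ} (hρ : 0 < ρ) (hρalg : IsAlgebraic ℚ (ρ : ℂ))
    (hsmall : ∀ j, j ≠ c → ρ ^ 2 < Complex.normSq (a c - a j)) (γ : CurvePath (ZP a))
    (hγ : ∀ t ∈ Icc (0 : ℝ) 1, γ.toFun t =
      ![a c + ρ * exp (2 * π * I * t), (∏ i, (a c + ρ * exp (2 * π * I * t) - a i))⁻¹])
    {m : ℕ} (M : Fin m → ℂ) (E : Fin m → CurvePath 𝔾m)
    (hE : ∀ j t, (E j).toFun t = ![exp ((1 - t) * 0 + t * M j), exp (-((1 - t) * 0 + t * M j))])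
    (j₀ : Fin m) (hj₀ : M j₀ = 2 * π * I) :
    InSpanRel (Finsupp.single (⟨ZP a, isSmoothAffineCurve_puncturedLine ha, inputForm a rc pc,
        hasAlgCoeffs_inputForm ha hrc hpc, γ⟩ : PeriodSymbol) (1 : ℂ) -
      ∑ j, (if j₀ = j then rc c else 0) • Finsupp.single (logSym (E j)) (1 : ℂ) -
      (0 : ℂ) • Finsupp.single PeriodSymbol.unit (1 : ℂ)) := by
  have h := span_loopSymbol ha hrc hpc c hρ hρalg hsmall γ hγ (E j₀) (fun t => by rw [hE, hj₀])
  have e : ∑ j, (if j₀ = j then rc c else 0) • Finsupp.single (logSym (E j)) (1 : ℂ) =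
      rc c • Finsupp.single (logSym (E j₀)) (1 : ℂ) := by
    simp_rw [ite_smul, zero_smul]
    rw [Finset.sum_ite_eq, if_pos (Finset.mem_univ _)]
  rwa [e, zero_smul, sub_zero]

/-- All poles `aᵢ` miss the segment `[z₀, z₁]` (coordinate test, see `not_mem_segment`).
[folklore] -/
theorem segment_misses {a : Fin r → ℂ} {z₀ z₁ : ℂ}
    (h : ∀ i, ((a i - z₀) * (starRingEnd ℂ) (z₁ - z₀)).im ≠ 0 ∨
      ((a i - z₀) * (starRingEnd ℂ) (z₁ - z₀)).re < 0 ∨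
      Complex.normSq (z₁ - z₀) < ((a i - z₀) * (starRingEnd ℂ) (z₁ - z₀)).re) :
    ∀ i, ∀ t ∈ Icc (0 : ℝ) 1, z₀ + (t : ℂ) * (z₁ - z₀) ≠ a i :=
  fun i => not_mem_segment (h i)

/-- The loop radius condition from the coordinates (`ρ²` rational, distances in `K`). [folklore] -/
theorem normSq_sub_eq {x₁ y₁ x₂ y₂ : ℝ} :
    Complex.normSq ((⟨x₁, y₁⟩ : ℂ) - ⟨x₂, y₂⟩) = (x₁ - x₂) ^ 2 + (y₁ - y₂) ^ 2 := by
  simp [Complex.normSq_apply]; ring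

end Interface

end Summit.KontsevichZagierPeriods.KzOnePeriods.G0Derivation

end
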